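import Summits.NavierStokesRegularity.NavierStokesRegularity.Theorems.PalasekTowerBreakdownEpisodeBaseStrainSliceH1
import Summits.NavierStokesRegularity.NavierStokesRegularity.Theorems.PalasekTowerBreakdownEpisodeBaseStrainPairingLevelTwoStretching
import Literature.Analysis.FluidPDE.TaoEnstrophyLocalisationProofs

/-!
# The strain-currency door at the `H²` level, I: commutation tools (`∂ₗΔ = Δ∂ₗ`, `∂ₗ∇ = ∇∂ₗ`) and the
# derivative of the right-hand side of the difference equation

Cell `ns-blowup`, seat `ns-palasek-19179-p2` (g6; `--supports stmt-NavierStokesRegularity-19179`; support for the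
stub `stub_strain_door` of the line `Cruxes/EpisodeBase/Lines/straindoor.lean`). LABEL: E–C analysis (KERNEL:
theorems only; no definition, no named fact, no `sorry`; register-free). WHAT THIS IS NOT: not Navier–Stokes evidence
— calculus identities; nothing about any flow, design or blow-up.

* `fderiv_apply_laplacian_eq` — `∂ₑ(ΔW) = Δ(∂ₑW)` for `C³` fields.
* `fderiv_apply_gradient_eq` — `∂ₑ(∇π) = ∇(∂ₑπ)` for `C²` scalars.
* `fderiv_apply_rhs_eq` — for `A = ΔW − [(W·∇)u + (u·∇)W + (W·∇)W] − ∇π − r` (all terms `C¹`):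
  `∂ₑA = Δ(∂ₑW) − ∂ₑ[(W·∇)u] − ∂ₑ[(u·∇)W] − ∂ₑ[(W·∇)W] − ∇(∂ₑπ) − ∂ₑr`.
* `abs_sum_sum_integral_inner_le_sqrt_mul_sqrt` — finite Cauchy–Schwarz over a double index.

References: P. Constantin, C. Foias, *Navier–Stokes Equations*, 1988, Ch. 10 [cite: ConstantinFoiasNSE1988, Ch. 10 Thm. 10.2].
-/

noncomputable section

set_option linter.dupNamespace false

open MeasureTheory Filter Function Set
open scoped ENNReal NNReal RealInnerProductSpace Topology Laplacian
open Literature.Analysis.FunctionSpaces Literature.Analysis.FluidPDE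

namespace Summit.NavierStokesRegularity.NavierStokesRegularity.Theorems.StrainPairing

variable {E : Type*} [NormedAddCommGroup E] [InnerProductSpace ℝ E] [FiniteDimensional ℝ E]
  [MeasurableSpace E] [BorelSpace E]
variable {E' : Type*} [NormedAddCommGroup E'] [InnerProductSpace ℝ E'] [FiniteDimensional ℝ E']

omit [MeasurableSpace E] [BorelSpace E] [FiniteDimensional ℝ E'] in
/-- **`∂ₑ(ΔW) = Δ(∂ₑW)`** for a `C³` field (`Δ = ∑ₖ ∂ₖ∂ₖ` over the standard frame, and mixed partials commute
twice). [cite: ConstantinFoiasNSE1988, Ch. 10 Thm. 10.2] -/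
theorem fderiv_apply_laplacian_eq {W : E → E'} (hW : ContDiff ℝ 3 W) (x e : E) :
    fderiv ℝ (Δ W) x e = (Δ (fun y => fderiv ℝ W y e)) x := by
  set b := stdOrthonormalBasis ℝ E with hb
  have hW2 : ContDiff ℝ 2 W := hW.of_le (by norm_num)
  have hV : ∀ w : E, ContDiff ℝ 2 (fun y => fderiv ℝ W y w) := fun w =>
    (hW.fderiv_right (m := 2) (by norm_num)).clm_apply contDiff_const
  have hVV : ∀ w w' : E, ContDiff ℝ 1 (fun y => fderiv ℝ (fun z => fderiv ℝ W z w) y w') := fun w w' =>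
    ((hV w).fderiv_right (m := 1) (by norm_num)).clm_apply contDiff_const
  -- `ΔW = ∑ₖ ∂ₖ∂ₖ W` as functions, then differentiate the finite sum
  have hΔ : Δ W = fun y => ∑ k, fderiv ℝ (fun z => fderiv ℝ W z (b k)) y (b k) :=
    funext fun y => laplacian_eq_sum_fderiv_fderiv b hW2 y
  rw [hΔ, laplacian_eq_sum_fderiv_fderiv b (hV e) x]
  have hsum : (fun y => ∑ k, fderiv ℝ (fun z => fderiv ℝ W z (b k)) y (b k)) =
      ∑ k, fun y => fderiv ℝ (fun z => fderiv ℝ W z (b k)) y (b k) := by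
    funext y; simp
  rw [hsum, fderiv_sum fun k _ => ((hVV (b k) (b k)).differentiable one_ne_zero x)]
  simp only [FunLike.coe_sum, Finset.sum_apply]
  refine Finset.sum_congr rfl fun k _ => ?_
  -- `∂ₑ ∂ₖ ∂ₖ W = ∂ₖ ∂ₑ ∂ₖ W = ∂ₖ ∂ₖ ∂ₑ W`
  rw [fderiv_fderiv_apply_comm (hV (b k)) x (b k) e]
  have hfun : (fun y => fderiv ℝ (fun z => fderiv ℝ W z (b k)) y e) = fun y => fderiv ℝ (fun z => fderiv ℝ W z e) y (b k) :=
    funext fun y => fderiv_fderiv_apply_comm hW2 y (b k) e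
  rw [hfun]

omit [MeasurableSpace E] [BorelSpace E] in
/-- **`∂ₑ(∇π) = ∇(∂ₑπ)`** for a `C²` scalar (the Riesz map is linear and mixed partials commute).
[cite: ConstantinFoiasNSE1988, Ch. 10 Thm. 10.2] -/
theorem fderiv_apply_gradient_eq {π : E → ℝ} (hπ : ContDiff ℝ 2 π) (x e : E) :
    fderiv ℝ (gradient π) x e = gradient (fun y => fderiv ℝ π y e) x := by
  haveI : CompleteSpace E := FiniteDimensional.complete ℝ E
  have hd : DifferentiableAt ℝ (fderiv ℝ π) x := ((hπ.fderiv_right (m := 1) le_rfl).differentiable one_ne_zero) x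
  have hrep : gradient π = fun y => (InnerProductSpace.toDual ℝ E).symm (fderiv ℝ π y) := rfl
  rw [hrep]
  have h1 : fderiv ℝ (fun y => (InnerProductSpace.toDual ℝ E).symm (fderiv ℝ π y)) x e =
      (InnerProductSpace.toDual ℝ E).symm (fderiv ℝ (fderiv ℝ π) x e) := by
    have := ((InnerProductSpace.toDual ℝ E).symm.toContinuousLinearEquiv.toContinuousLinearMap.hasFDerivAt.comp x
      hd.hasFDerivAt).fderiv
    rw [show (fun y => (InnerProductSpace.toDual ℝ E).symm (fderiv ℝ π y)) =
      ⇑(InnerProductSpace.toDual ℝ E).symm.toContinuousLinearEquiv.toContinuousLinearMap ∘ fderiv ℝ π from rfl, this]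
    rfl
  rw [h1, gradient]
  congr 1
  -- `D²π(x) e = D(∂ₑπ)(x)` as continuous linear maps, by symmetry of second derivatives
  ext w
  rw [fderiv_fderiv_apply_comm hπ x e w]
  have hdw : DifferentiableAt ℝ (fderiv ℝ π) x := hd
  rw [fderiv_clm_apply hdw (differentiableAt_const w)]
  simp

omit [MeasurableSpace E] [BorelSpace E] [FiniteDimensional ℝ E'] in
/-- The derivative of the right-hand side of the difference equation, term by term:
`∂ₑ(ΔW − N₁ − N₂ − N₃ − ∇π − r) = Δ(∂ₑW) − ∂ₑN₁ − ∂ₑN₂ − ∂ₑN₃ − ∇(∂ₑπ) − ∂ₑr` (all terms `C¹`).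
[cite: ConstantinFoiasNSE1988, Ch. 10 Thm. 10.2] -/
theorem fderiv_apply_rhs_eq {W N₁ N₂ N₃ r A : E → E} {π : E → ℝ} (hW : ContDiff ℝ 3 W)
    (hN₁ : ContDiff ℝ 1 N₁) (hN₂ : ContDiff ℝ 1 N₂) (hN₃ : ContDiff ℝ 1 N₃) (hπ : ContDiff ℝ 2 π) (hr : ContDiff ℝ 1 r)
    (hA : A = fun x => (Δ W) x - (N₁ x + N₂ x + N₃ x) - gradient π x - r x) (x e : E) :
    fderiv ℝ A x e = (Δ (fun y => fderiv ℝ W y e)) x - (fderiv ℝ N₁ x e + fderiv ℝ N₂ x e + fderiv ℝ N₃ x e) -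
      gradient (fun y => fderiv ℝ π y e) x - fderiv ℝ r x e := by
  haveI : CompleteSpace E := FiniteDimensional.complete ℝ E
  set b := stdOrthonormalBasis ℝ E with hb
  -- `ΔW` and `∇π` are `C¹`
  have hΔc : ContDiff ℝ 1 (Δ W) := by
    have hΔ : Δ W = fun y => ∑ k, fderiv ℝ (fun z => fderiv ℝ W z (b k)) y (b k) :=
      funext fun y => laplacian_eq_sum_fderiv_fderiv b (hW.of_le (by norm_num)) y
    have hVV : ∀ k, ContDiff ℝ 1 (fun y => fderiv ℝ (fun z => fderiv ℝ W z (b k)) y (b k)) := fun k =>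
      ((((hW.fderiv_right (m := 2) (by norm_num)).clm_apply contDiff_const).fderiv_right (m := 1)
        (by norm_num)).clm_apply contDiff_const)
    rw [hΔ]; exact ContDiff.sum fun k _ => hVV k
  have hgc : ContDiff ℝ 1 (gradient π) := by
    have hrep : gradient π = fun y => (InnerProductSpace.toDual ℝ E).symm (fderiv ℝ π y) := rfl
    rw [hrep]
    exact (InnerProductSpace.toDual ℝ E).symm.toContinuousLinearEquiv.toContinuousLinearMap.contDiff.comp
      (hπ.fderiv_right (m := 1) le_rfl)
  have dΔ : Differentiable ℝ (Δ W) := hΔc.differentiable one_ne_zero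
  have dg : Differentiable ℝ (gradient π) := hgc.differentiable one_ne_zero
  have d1 : Differentiable ℝ N₁ := hN₁.differentiable one_ne_zero
  have d2 : Differentiable ℝ N₂ := hN₂.differentiable one_ne_zero
  have d3 : Differentiable ℝ N₃ := hN₃.differentiable one_ne_zero
  have dr : Differentiable ℝ r := hr.differentiable one_ne_zero
  have hs : A = Δ W - (N₁ + N₂ + N₃) - gradient π - r := by rw [hA]; funext y; simp
  rw [hs, fderiv_sub (((dΔ.sub ((d1.add d2).add d3)).sub dg) x) (dr x),
    fderiv_sub ((dΔ.sub ((d1.add d2).add d3)) x) (dg x), fderiv_sub (dΔ x) (((d1.add d2).add d3) x),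
    fderiv_add ((d1.add d2) x) (d3 x), fderiv_add (d1 x) (d2 x)]
  simp only [sub_apply, add_apply]
  rw [fderiv_apply_laplacian_eq hW, fderiv_apply_gradient_eq hπ]

omit [FiniteDimensional ℝ E'] in
/-- **Finite Cauchy–Schwarz for a double sum of `L²` pairings**:
`|∑ₗ∑ₖ ∫⟪fₗₖ, gₗₖ⟫| ≤ √(∑ₗ∑ₖ∫‖fₗₖ‖²) √(∑ₗ∑ₖ∫‖gₗₖ‖²)`. [cite: ConstantinFoiasNSE1988, Ch. 10 Thm. 10.2] -/
theorem abs_sum_sum_integral_inner_le_sqrt_mul_sqrt {ι : Type*} [Fintype ι] {f g : ι → ι → E → E'}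
    (hf : ∀ l k, MemLp (f l k) 2 volume) (hg : ∀ l k, MemLp (g l k) 2 volume) :
    |∑ l, ∑ k, ∫ x, ⟪f l k x, g l k x⟫| ≤
      Real.sqrt (∑ l, ∑ k, ∫ x, ‖f l k x‖ ^ 2) * Real.sqrt (∑ l, ∑ k, ∫ x, ‖g l k x‖ ^ 2) := by
  have h := abs_sum_integral_inner_le_sqrt_mul_sqrt (ι := ι × ι) (f := fun p => f p.1 p.2) (g := fun p => g p.1 p.2)
    (fun p => hf p.1 p.2) (fun p => hg p.1 p.2)
  simp only [Fintype.sum_prod_type] at h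
  exact h

/-- **Finite Cauchy–Schwarz for sums of products of nonnegative `L²` functions**:
`∑ₗ ∫ aₗ cₗ ≤ √(∑ₗ∫aₗ²) √(∑ₗ∫cₗ²)`. [cite: ConstantinFoiasNSE1988, Ch. 10 Thm. 10.2] -/
theorem sum_integral_mul_le_sqrt_mul_sqrt {ι : Type*} [Fintype ι] {a c : ι → E → ℝ}
    (ha : ∀ l, MemLp (a l) 2 volume) (hc : ∀ l, MemLp (c l) 2 volume)
    (ha0 : ∀ l x, 0 ≤ a l x) (hc0 : ∀ l x, 0 ≤ c l x) :
    ∑ l, ∫ x, a l x * c l x ≤ Real.sqrt (∑ l, ∫ x, a l x ^ 2) * Real.sqrt (∑ l, ∫ x, c l x ^ 2) := by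
  have hA0 : ∀ l, 0 ≤ ∫ x, a l x ^ 2 := fun l => integral_nonneg fun x => sq_nonneg _
  have hC0 : ∀ l, 0 ≤ ∫ x, c l x ^ 2 := fun l => integral_nonneg fun x => sq_nonneg _
  have hk : ∀ l, ∫ x, a l x * c l x ≤ Real.sqrt (∫ x, a l x ^ 2) * Real.sqrt (∫ x, c l x ^ 2) := by
    intro l
    have h2 := integral_mul_le_Lp_mul_Lq_of_nonneg (μ := (volume : Measure E)) Real.HolderConjugate.two_two
      (Eventually.of_forall fun x => ha0 l x) (Eventually.of_forall fun x => hc0 l x)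
      (by simpa using ha l) (by simpa using hc l)
    refine h2.trans (le_of_eq ?_)
    rw [Real.sqrt_eq_rpow, Real.sqrt_eq_rpow]
    norm_num
  calc ∑ l, ∫ x, a l x * c l x ≤ ∑ l, Real.sqrt (∫ x, a l x ^ 2) * Real.sqrt (∫ x, c l x ^ 2) :=
        Finset.sum_le_sum fun l _ => hk l
    _ ≤ Real.sqrt (∑ l, ∫ x, a l x ^ 2) * Real.sqrt (∑ l, ∫ x, c l x ^ 2) := by
        have hcs := Finset.sum_mul_sq_le_sq_mul_sq Finset.univ
          (fun l => Real.sqrt (∫ x, a l x ^ 2)) (fun l => Real.sqrt (∫ x, c l x ^ 2))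
        simp only [Real.sq_sqrt (hA0 _), Real.sq_sqrt (hC0 _)] at hcs
        have hpos : 0 ≤ ∑ l, Real.sqrt (∫ x, a l x ^ 2) * Real.sqrt (∫ x, c l x ^ 2) :=
          Finset.sum_nonneg fun l _ => mul_nonneg (Real.sqrt_nonneg _) (Real.sqrt_nonneg _)
        have hsq : (∑ l, Real.sqrt (∫ x, a l x ^ 2) * Real.sqrt (∫ x, c l x ^ 2)) ^ 2 ≤
            (Real.sqrt (∑ l, ∫ x, a l x ^ 2) * Real.sqrt (∑ l, ∫ x, c l x ^ 2)) ^ 2 := by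
          rw [mul_pow, Real.sq_sqrt (Finset.sum_nonneg fun l _ => hA0 l),
            Real.sq_sqrt (Finset.sum_nonneg fun l _ => hC0 l)]
          exact hcs
        exact (pow_le_pow_iff_left₀ hpos (by positivity) two_ne_zero).1 hsq

end Summit.NavierStokesRegularity.NavierStokesRegularity.Theorems.StrainPairing

end
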